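import Mathlib.LinearAlgebra.Matrix.Notation
import Mathlib.LinearAlgebra.Matrix.Determinant.Basic
import Mathlib.GroupTheory.GroupAction.Quotient
import Mathlib.Algebra.BigOperators.GroupWithZero.Action
import Mathlib.Tactic
import HarnessLib

/-!
# Route `SylvesterTwoHeegnerIndex` (rung K7t), `p ≡ 4 (mod 9)` side: the KERNEL CERTIFICATE of memo THEOREM D's
# explicit `3`-adic identity (complex conjugation of the CM point; memo bsd-cm-two §15.6)

Cell `b2b-bsdres`, seat x1b GEN 49 (prover-b2b-bsdres-x1b-g49-0), O12/O10 class lead; helper toward the K7t cone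
(`--supports … --as helper`). PARTITION (D55): CornerF at `p = 2` (B14/O12) × 𝒞_HSY ∩ {p ≡ 4 (mod 9)} (classes
`p ≡ 4, 13, 22 (mod 27)`) × `p = 2` — types-the-object-of; closes no cell and no item; BSD is not claimed. NO
definition, NO named fact, NO `sorry`: explicit `2 × 2` matrices over `ℚ` (companion of
`…ThmCShimuraCertificate` = the `p ≡ 7 (mod 9)` side, and of `…ModularActionCertificates`).

CONTEXT. MEMO bsd-cm-two §15.6 THEOREM D: for every prime `p ≡ 4 (mod 9)`, `conj(σ_{−1}(P₀)) = [ω^{e(p)}]·P₀` in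
`E_9(H_{9p})`, `e(p)` depending only on `p mod 27` (`e = 0` for `p ≡ 4 (27)`, `e = ±1` for `p ≡ 13, 22 (27)`);
with Theorem C's method this is what lies behind HSY's exponent `i = 0` on this class, Corollary D1 («the γ of
HSY Prop 3.3 is trivial», `R̄₁ = [ω^e]R₁`) and the INDEX FORM Theorem B′ (`#Ш_an(E_p)·#Ш(E_{3p²}) = 2^i·r(p)²`). Its
proof has ONE explicit computation (memo, kit j237915): with `w = [[−2p − 17, 4p/9 + 4], [−9p − 72, 2p + 17]]`
(Hu–Shu–Yin p. 6; `w² = 1`, `wρ(t)w⁻¹ = ρ(t̄)`, `wτ = τ̄`) and `g := W, A·W·B⁻¹, A·B·W` for `p ≡ 4, 13, 22 (mod 27)`,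
`X(p) := w·ρ(√−3)⁻¹·g⁻¹` has `det X = −3⁻⁶` and `27·X(p) ∈ U₀(3⁵)₃` — whence `(wρ(√−3)⁻¹)₃ ∈ ℚ₃^×·U₀(3⁵)₃·g(p)` and
`conj(σ_{−1}P₀) = θ_{g(p)}(P₀)` (`θ_W = θ_A = id`, `θ_B = [ω²]`, HSY Prop 2.1). The memo decided it «by `p mod 3³`»
plus an exhaustive check over the `6561` residues `p ≡ 4 (9) (mod 3¹⁰)`; THIS FILE PROVES IT FOR EVERY INTEGER `p`
OF EACH CLASS.

ENCODING (definition-free, as in the companions). Since `ρ(√−3)² = −3`, `ρ(√−3)⁻¹ = −ρ(√−3)/3`, so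
`27·X(p)·g = −9·w·ρ(√−3)`; for an integer `p` with `3 ∤ p` we exhibit an INTEGER matrix `Z = 27p·X(p)` with
`Z·g = −9p·(w·ρ(√−3))`, `det Z = −p²` (so `det(27X) = −1`, a unit) and `3⁵ ∣ Z₂₁`; hence `27·X(p) = p⁻¹Z ∈ U₀(3⁵)₃`
(entries `3`-integral, lower-left `≡ 0 (mod 3⁵)`, unit determinant; NOT in `V`: `det ≡ −1 (mod 3)`, as it must be
for an element carrying the complex conjugation `ε`). The product `w·ρ(√−3)` is written out once
(`w_mul_one_add_two_rhoOmega`) and used as a literal in the certificates. Lean indices are `0`-based.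

* `w_mul_one_add_two_rhoOmega` — `w·ρ(√−3) = [[2p − 17 − 72/p, −4p/9 + 4 + 18/p], [9p − 72 − 288/p, −2p + 17 + 72/p]]`.
* `w_conj_tau` — `w` maps `τ = (2pω − 9)/(9pω − 36)` to `τ̄` (homogeneous coordinates, `ω̄ = −1 − ω`).
* `thmD_cert_four_mod_twentySeven` / `…_thirteen_…` / `…_twentyTwo_…` — the identity for `g = W`, `A·W·B⁻¹`, `A·B·W`.
* `thmD_conjugation_certificate` — assembled under the single hypothesis `p % 9 = 4`, with `3 ∤ p`.
* §4 (APPEND, x1b GEN 49) `smul_sum_smul_eq_sum_inv_smul`, `smul_trace_eq_map_trace_of_conj_inv` — the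
  ABSTRACT SKELETON of Corollary D1 («the γ of HSY Prop 3.3 is trivial»): if `c` (complex conjugation) inverts a finite
  subgroup `T` (`cσc⁻¹ = σ⁻¹`, dihedral relation) and `c•P₀ = φ(σ₁•P₀)` for an additive `φ` commuting with `T`
  (`φ = [ω^{e(p)}]`, `σ₁ = σ_{−1} ∈ T` by Theorem D), then `c • Tr_T P₀ = φ(Tr_T P₀)`, i.e. `R̄₁ = [ω^e]R₁`.

WHAT THIS IS NOT: not Theorem D (no CM point, no complex conjugation on `X_Γ⁰`, no Galois action in the tree);
not a statement about `p ≡ 7 (mod 9)`; nothing here is a named fact.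

## References
* Y. Hu, J. Shu, H. Yin, Trans. AMS 372 (2019) = arXiv:1708.05266, §2.1 (`U₀(3⁵)`, `W`, `A`, `B`, Prop 2.1: `Φ(B) = [ω²]`),
  §2.2 (p. 6: `ρ(ω)`, `τ`, `w`; Thm 2.3).
* MEMO bsd-cm-two v2.6/v2.7 §15.6 THEOREM D (kit j237915), Corollary D1, Theorem B′; §15.5 (C-b) for `σ_{−1}`.
* Exact re-derivation: HOME/b2b-bsdres-x1b/gen49/tools/thmD_certs.py (the integer matrices `Z(s)` below are its output).
-/

set_option autoImplicit false
-- the Summit-side namespace `Summit.BirchSwinnertonDyer.BirchSwinnertonDyer.…` (summit = problem) is mandated by D-0017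
set_option linter.dupNamespace false

namespace Summit.BirchSwinnertonDyer.BirchSwinnertonDyer.Theorems.SylvesterTwoThmDCert

open Matrix

/-! ## §1 `w·ρ(√−3)` and `wτ = τ̄` -/

/-- **`w·ρ(√−3)` written out** (every `p ≠ 0`):
`w·ρ(√−3) = [[2p − 17 − 72/p, −4p/9 + 4 + 18/p], [9p − 72 − 288/p, −2p + 17 + 72/p]]`
(`w = [[−2p − 17, 4p/9 + 4], [−9p − 72, 2p + 17]]`, `ρ(√−3) = 1 + 2ρ(ω)`). [cite: HuShuYin2019, §2.2 (ρ(ω), w)] -/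
theorem w_mul_one_add_two_rhoOmega (p : ℚ) (hp : p ≠ 0) :
    (!![-(2 * p) - 17, 4 * p / 9 + 4; -(9 * p) - 72, 2 * p + 17] : Matrix (Fin 2) (Fin 2) ℚ) * !![4 * p + 17 + 72 / p, -(8 / 9) * p - 4 - 18 / p; 18 * p + 72 + 288 / p, -(4 * p) - 17 - 72 / p] =
      !![2 * p - 17 - 72 / p, -(4 / 9) * p + 4 + 18 / p; 9 * p - 72 - 288 / p, -(2 * p) + 17 + 72 / p] := by
  ext i j
  fin_cases i <;> fin_cases j <;> simp <;> field_simp <;> ring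

/-- **`w` maps `τ` to its complex conjugate** (memo §15.6: «`wτ = τ̄`»): in homogeneous coordinates and over any
field of characteristic `0` containing `ω` with `ω² + ω + 1 = 0`, writing `ω̄ = −1 − ω`,
`w·(2pω − 9, 9pω − 36)ᵗ = −(2pω̄ − 9, 9pω̄ − 36)ᵗ`. [cite: HuShuYin2019, §2.2 (τ, w)] -/
theorem w_conj_tau {K : Type*} [Field K] [CharZero K] (ω p : K) :
    (-(2 * p) - 17) * (2 * p * ω - 9) + (4 * p / 9 + 4) * (9 * p * ω - 36) = -(2 * p * (-1 - ω) - 9) ∧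
      (-(9 * p) - 72) * (2 * p * ω - 9) + (2 * p + 17) * (9 * p * ω - 36) = -(9 * p * (-1 - ω) - 36) := by
  constructor <;> ring

/-! ## §2 The three certificates (memo §15.6, explicit identity): `Z = 27p·X(p)`, `Z·g = −9p·(w·ρ(√−3))` -/

/-- **THEOREM D's identity for `p ≡ 4 (mod 27)`, `g = W`** (W): an INTEGER matrix `Z` (`= 27p·X(p)`,
`X(p) = w·ρ(√−3)⁻¹·g⁻¹`) with `Z·g = −9p·(w·ρ(√−3))`, `det Z = −p²`, `3⁵ ∣ Z₂₁` (for `p = 27s + 4`: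
`Z₂₁ = 3⁵·(54 · s² - s - 4)`). Since `3 ∤ p`: `27·X(p) = p⁻¹Z ∈ U₀(3⁵)₃` with determinant `−1`.
[cite: HuShuYin2019, §2.1–2.2 (W, A, B, ρ, w)] -/
theorem thmD_cert_four_mod_twentySeven (p : ℤ) (hp : p % 27 = 4) :
    ∃ Z : Matrix (Fin 2) (Fin 2) ℤ,
      Z.map (Int.cast : ℤ → ℚ) * ((!![0, 1; -243, 0] : Matrix (Fin 2) (Fin 2) ℚ)) =
        ((-9 : ℚ) * (p : ℚ)) • !![2 * (p : ℚ) - 17 - 72 / (p : ℚ), -(4 / 9) * (p : ℚ) + 4 + 18 / (p : ℚ);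
          9 * (p : ℚ) - 72 - 288 / (p : ℚ), -(2 * (p : ℚ)) + 17 + 72 / (p : ℚ)] ∧
      Z.det = -p ^ 2 ∧ (3 : ℤ) ^ 5 ∣ Z 1 0 := by
  obtain ⟨s, rfl⟩ : ∃ s : ℤ, p = 27 * s + 4 := ⟨p / 27, by omega⟩
  refine ⟨!![2916 * s ^ 2 - 108 * s - 242, 54 * s ^ 2 - s - 4;
      13122 * s ^ 2 - 243 * s - 972, 243 * s ^ 2 - 16], ?_, ?_, ?_⟩
  · have hp0 : ((27 * s + 4 : ℤ) : ℚ) ≠ 0 := by exact_mod_cast (show (27 * s + 4 : ℤ) ≠ 0 by omega)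
    have hinv : ((27 * s + 4 : ℤ) : ℚ) * ((27 * s + 4 : ℤ) : ℚ)⁻¹ = 1 := mul_inv_cancel₀ hp0
    push_cast at hinv ⊢
    ext i j
    fin_cases i <;> fin_cases j <;> simp [Matrix.mul_apply, Fin.sum_univ_two]
    · linear_combination (648 : ℚ) * hinv
    · linear_combination (162 : ℚ) * hinv
    · linear_combination (2592 : ℚ) * hinv
    · linear_combination (648 : ℚ) * hinv
  · rw [Matrix.det_fin_two_of]
    ring
  · exact ⟨54 * s ^ 2 - s - 4, by simp; ring⟩

/-- **THEOREM D's identity for `p ≡ 13 (mod 27)`, `g = A·W·B⁻¹` (`B⁻¹ = [[1, 0], [−81, 1]]`)** (A·W·B⁻¹ = [[−2349, 28], [−6804, 81]]): an INTEGER matrix `Z` (`= 27p·X(p)`,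
`X(p) = w·ρ(√−3)⁻¹·g⁻¹`) with `Z·g = −9p·(w·ρ(√−3))`, `det Z = −p²`, `3⁵ ∣ Z₂₁` (for `p = 27s + 13`:
`Z₂₁ = 3⁵·(1431 · s² + 926 · s + 43)`). Since `3 ∤ p`: `27·X(p) = p⁻¹Z ∈ U₀(3⁵)₃` with determinant `−1`.
[cite: HuShuYin2019, §2.1–2.2 (W, A, B, ρ, w)] -/
theorem thmD_cert_thirteen_mod_twentySeven (p : ℤ) (hp : p % 27 = 13) :
    ∃ Z : Matrix (Fin 2) (Fin 2) ℤ,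
      Z.map (Int.cast : ℤ → ℚ) * ((!![28, 1 / 3; 81, 1] : Matrix (Fin 2) (Fin 2) ℚ) * !![0, 1; -243, 0] * !![1, 0; -81, 1]) =
        ((-9 : ℚ) * (p : ℚ)) • !![2 * (p : ℚ) - 17 - 72 / (p : ℚ), -(4 / 9) * (p : ℚ) + 4 + 18 / (p : ℚ);
          9 * (p : ℚ) - 72 - 288 / (p : ℚ), -(2 * (p : ℚ)) + 17 + 72 / (p : ℚ)] ∧
      Z.det = -p ^ 2 ∧ (3 : ℤ) ^ 5 ∣ Z 1 0 := by
  obtain ⟨s, rfl⟩ : ∃ s : ℤ, p = 27 * s + 13 := ⟨p / 27, by omega⟩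
  refine ⟨!![77274 * s ^ 2 + 48573 * s + 1153, -26676 * s ^ 2 - 16768 * s - 398;
      347733 * s ^ 2 + 225018 * s + 10449, -120042 * s ^ 2 - 77679 * s - 3607], ?_, ?_, ?_⟩
  · have hp0 : ((27 * s + 13 : ℤ) : ℚ) ≠ 0 := by exact_mod_cast (show (27 * s + 13 : ℤ) ≠ 0 by omega)
    have hinv : ((27 * s + 13 : ℤ) : ℚ) * ((27 * s + 13 : ℤ) : ℚ)⁻¹ = 1 := mul_inv_cancel₀ hp0
    push_cast at hinv ⊢
    ext i j
    fin_cases i <;> fin_cases j <;> simp [Matrix.mul_apply, Fin.sum_univ_two]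
    · linear_combination (-648 : ℚ) * hinv
    · linear_combination (162 : ℚ) * hinv
    · linear_combination (-2592 : ℚ) * hinv
    · linear_combination (648 : ℚ) * hinv
  · rw [Matrix.det_fin_two_of]
    ring
  · exact ⟨1431 * s ^ 2 + 926 * s + 43, by simp; ring⟩

/-- **THEOREM D's identity for `p ≡ 22 (mod 27)`, `g = A·B·W`** (A·B·W = [[−81, 55], [−243, 162]]): an INTEGER matrix `Z` (`= 27p·X(p)`,
`X(p) = w·ρ(√−3)⁻¹·g⁻¹`) with `Z·g = −9p·(w·ρ(√−3))`, `det Z = −p²`, `3⁵ ∣ Z₂₁` (for `p = 27s + 22`: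
`Z₂₁ = 3⁵·(-108 · s² - 145 · s - 42)`). Since `3 ∤ p`: `27·X(p) = p⁻¹Z ∈ U₀(3⁵)₃` with determinant `−1`.
[cite: HuShuYin2019, §2.1–2.2 (W, A, B, ρ, w)] -/
theorem thmD_cert_twentyTwo_mod_twentySeven (p : ℤ) (hp : p % 27 = 22) :
    ∃ Z : Matrix (Fin 2) (Fin 2) ℤ,
      Z.map (Int.cast : ℤ → ℚ) * ((!![28, 1 / 3; 81, 1] : Matrix (Fin 2) (Fin 2) ℚ) * !![1, 0; 81, 1] * !![0, 1; -243, 0]) =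
        ((-9 : ℚ) * (p : ℚ)) • !![2 * (p : ℚ) - 17 - 72 / (p : ℚ), -(4 / 9) * (p : ℚ) + 4 + 18 / (p : ℚ);
          9 * (p : ℚ) - 72 - 288 / (p : ℚ), -(2 * (p : ℚ)) + 17 + 72 / (p : ℚ)] ∧
      Z.det = -p ^ 2 ∧ (3 : ℤ) ^ 5 ∣ Z 1 0 := by
  obtain ⟨s, rfl⟩ : ∃ s : ℤ, p = 27 * s + 22 := ⟨p / 27, by omega⟩
  refine ⟨!![-5832 * s ^ 2 - 7722 * s - 2150, 1998 * s ^ 2 + 2645 * s + 736;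
      -26244 * s ^ 2 - 35235 * s - 10206, 8991 * s ^ 2 + 12069 * s + 3494], ?_, ?_, ?_⟩
  · have hp0 : ((27 * s + 22 : ℤ) : ℚ) ≠ 0 := by exact_mod_cast (show (27 * s + 22 : ℤ) ≠ 0 by omega)
    have hinv : ((27 * s + 22 : ℤ) : ℚ) * ((27 * s + 22 : ℤ) : ℚ)⁻¹ = 1 := mul_inv_cancel₀ hp0
    push_cast at hinv ⊢
    ext i j
    fin_cases i <;> fin_cases j <;> simp [Matrix.mul_apply, Fin.sum_univ_two]
    · linear_combination (-648 : ℚ) * hinv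
    · linear_combination (162 : ℚ) * hinv
    · linear_combination (-2592 : ℚ) * hinv
    · linear_combination (648 : ℚ) * hinv
  · rw [Matrix.det_fin_two_of]
    ring
  · exact ⟨-108 * s ^ 2 - 145 * s - 42, by simp; ring⟩

/-! ## §3 Assembly under Theorem D's hypothesis `p ≡ 4 (mod 9)` -/

/-- **Memo THEOREM D, the explicit identity, for EVERY integer `p ≡ 4 (mod 9)`**: `3 ∤ p` and for
`g = W, A·W·B⁻¹, A·B·W` according as `p ≡ 4, 13, 22 (mod 27)` there is an integer matrix `Z = 27p·X(p)` with
`Z·g = −9p·(w·ρ(√−3))`, `det Z = −p²`, `3⁵ ∣ Z₂₁` — i.e. `27·w·ρ(√−3)⁻¹·g⁻¹ ∈ U₀(3⁵)₃` and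
`(w·ρ(√−3)⁻¹)₃ ∈ ℚ₃^× · U₀(3⁵)₃ · g(p)`: under Shimura reciprocity (HSY Thm 2.3) and HSY Prop 2.1 (`θ_W = θ_A = id`,
`θ_B = [ω²]`) this is what gives `conj(σ_{−1}P₀) = [ω^{e(p)}]P₀`, `e(4) = 0`, `e(13), e(22) = ±1` (memo §15.6); those
steps are NOT in the tree. [cite: HuShuYin2019, Thm 2.3, Prop 2.1, §2.1–2.2] -/
theorem thmD_conjugation_certificate (p : ℤ) (hp : p % 9 = 4) :
    ¬ (3 : ℤ) ∣ p ∧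
    ∃ (g : Matrix (Fin 2) (Fin 2) ℚ) (Z : Matrix (Fin 2) (Fin 2) ℤ),
      (g = !![0, 1; -243, 0] ∨ g = (!![28, 1 / 3; 81, 1] : Matrix (Fin 2) (Fin 2) ℚ) * !![0, 1; -243, 0] * !![1, 0; -81, 1] ∨
        g = (!![28, 1 / 3; 81, 1] : Matrix (Fin 2) (Fin 2) ℚ) * !![1, 0; 81, 1] * !![0, 1; -243, 0]) ∧
      Z.map (Int.cast : ℤ → ℚ) * g =
        ((-9 : ℚ) * (p : ℚ)) • !![2 * (p : ℚ) - 17 - 72 / (p : ℚ), -(4 / 9) * (p : ℚ) + 4 + 18 / (p : ℚ);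
          9 * (p : ℚ) - 72 - 288 / (p : ℚ), -(2 * (p : ℚ)) + 17 + 72 / (p : ℚ)] ∧
      Z.det = -p ^ 2 ∧ (3 : ℤ) ^ 5 ∣ Z 1 0 := by
  refine ⟨by omega, ?_⟩
  have h27 : p % 27 = 4 ∨ p % 27 = 13 ∨ p % 27 = 22 := by omega
  rcases h27 with h | h | h
  · obtain ⟨Z, hZ, hrest⟩ := thmD_cert_four_mod_twentySeven p h
    exact ⟨_, Z, Or.inl rfl, hZ, hrest⟩
  · obtain ⟨Z, hZ, hrest⟩ := thmD_cert_thirteen_mod_twentySeven p h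
    exact ⟨_, Z, Or.inr (Or.inl rfl), hZ, hrest⟩
  · obtain ⟨Z, hZ, hrest⟩ := thmD_cert_twentyTwo_mod_twentySeven p h
    exact ⟨_, Z, Or.inr (Or.inr rfl), hZ, hrest⟩

/-! ## §4 Corollary D1, abstract skeleton: a conjugation inverting the trace group commutes the trace through `φ`
(APPEND, x1b GEN 49) -/

/-- **Dihedral trace identity.** If `c ∈ G` inverts every element of a finite subgroup `T ≤ G`
(`c·σ·c⁻¹ = σ⁻¹`; e.g. complex conjugation on the abelian group `Gal(H_{9p}/K)`), then for every `x` in an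
additive `G`-module `M`: `c • ∑_{σ ∈ T} σ • x = ∑_{σ ∈ T} σ⁻¹ • (c • x)`. [folklore] -/
theorem smul_sum_smul_eq_sum_inv_smul {G M : Type*} [Group G] [AddCommMonoid M] [DistribMulAction G M]
    (T : Subgroup G) [Fintype T] (c : G) (hc : ∀ σ : T, c * (σ : G) * c⁻¹ = (σ : G)⁻¹) (x : M) :
    c • (∑ σ : T, (σ : G) • x) = ∑ σ : T, (σ : G)⁻¹ • (c • x) := by
  rw [Finset.smul_sum]
  refine Finset.sum_congr rfl fun σ _ => ?_
  rw [smul_smul, smul_smul, ← hc σ, inv_mul_cancel_right]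

/-- **Corollary D1, abstract skeleton (memo §15.6: «R̄₁ = [ω^{e(p)}]R₁ exactly»).** Let `c ∈ G` invert the finite
subgroup `T ≤ G` (`cσc⁻¹ = σ⁻¹`), let `φ : M →+ M` commute with the action of `T` (in the memo `φ = [ω^{e(p)}]`, a
CM endomorphism commuting with `Gal(H_{9p}/K)`), and suppose `c • x = φ(σ₁ • x)` for some `σ₁ ∈ T` (Theorem D with
`σ₁ = σ_{−1}`, which lies in the trace group `T = Gal(H_{9p}/L_{(3,p)})` by (C-a)). Then
`c • ∑_{σ ∈ T} σ • x = φ(∑_{σ ∈ T} σ • x)`: the conjugate of the trace `R₁` is `[ω^e]R₁`, so HSY Prop 3.3's `γ` is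
trivial and `y = r(p)·ζ` (index form, Theorem B′). The CM/Galois inputs are NOT in the tree; this is the group
theory only. [cite: HuShuYin2019, Prop 3.3 and p. 10 (R₁)] -/
theorem smul_trace_eq_map_trace_of_conj_inv {G M : Type*} [Group G] [AddCommMonoid M] [DistribMulAction G M]
    (T : Subgroup G) [Fintype T] (c : G) (hc : ∀ σ : T, c * (σ : G) * c⁻¹ = (σ : G)⁻¹) (φ : M →+ M)
    (hφ : ∀ σ : T, ∀ m : M, φ ((σ : G) • m) = (σ : G) • φ m) (σ₁ : T) (x : M)
    (hcx : c • x = φ ((σ₁ : G) • x)) :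
    c • (∑ σ : T, (σ : G) • x) = φ (∑ σ : T, (σ : G) • x) := by
  rw [smul_sum_smul_eq_sum_inv_smul T c hc x, hcx, map_sum]
  calc ∑ σ : T, (σ : G)⁻¹ • φ ((σ₁ : G) • x) = ∑ σ : T, φ (((σ⁻¹ * σ₁ : T) : G) • x) := by
        refine Finset.sum_congr rfl fun σ _ => ?_
        rw [← Subgroup.coe_inv, ← hφ, smul_smul, ← Subgroup.coe_mul]
    _ = ∑ τ : T, φ ((τ : G) • x) :=
        Fintype.sum_equiv ((Equiv.inv T).trans (Equiv.mulRight σ₁)) _ _ fun σ => rfl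

end Summit.BirchSwinnertonDyer.BirchSwinnertonDyer.Theorems.SylvesterTwoThmDCert
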